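import Mathlib
import HarnessLib
import HarnessLib.Audit
import Summits.Parity.Statement
import Literature.NumberTheory.Sieve.ParityWave0

/-!
Route: LeeYangDisc

CLOSED (retired) 2026-08-15T15:58:15Z by planner-Parity-route-Parity-LeeYangDisc-0 — reason: not-a-thesis: assembly does not conclude the sub-problem Statement — note: D-0027 §2.1 route-repair (glue.missing): every item of LeeYangDisc lives on f = X²+1 and the chain/Assembly concludes Literature.NumberTheory.Sieve.LandauConjecture (qualitative, reached through the EXPONENT form π₁(x) = x(log x)^{-1+o(1)}), not _root_.BatemanHorn (all systems, asymptotic WITH const. The file is kept as the record of this route; refuted decls are indexed as negative knowledge (`ledger negatives`).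

# Route LeeYangDisc — Landau as a Lee–Yang theorem — a zero-free disc for the ω-partition polynomial
of n²+1 gives primes n²+1 with the Bateman–Horn exponent

It suffices to show X := ZeroFreeDisc: there is δ > 0 such that for all large x the polynomial
P_x(z) := Σ_{1≤n≤x} z^{ω(n²+1)−1} = Σ_{j≥0} π_{j+1}(x) z^j (nonnegative integer coefficients
π_j(x) = #{n ≤ x : ω(n²+1) = j}; constant term P_x(0) = π₁(x) = #{n ≤ x : n²+1 a prime power}) has
NO
zero in the disc |z| < δ. The TRANSFER THEOREM (support items, provable now: RealAxisOrder =
fundamental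
lemma of a sieve of dimension 1−σ along n²+1, MontelTransfer = Montel/Vitali for half-plane-valued
families,
PrimePowersToLandau = prime powers n²+1 = p^k, k ≥ 3, are O(x^{2/3} log x)) turns X into
log(π₁(x)/x)/loglog x → −1, i.e. π₁(x) = x(log x)^{−1+o(1)} (Landau with the Bateman–Horn exponent),
hence
Literature.NumberTheory.Sieve.LandauConjecture. Realises card landau-lee-yang-zero-free-disc (master
of the
Lee–Yang family); crux HalfPlaneGap is the carried-over Conjecture HS of the merged card
lee-yang-zeros-hurwitz-landau,
crux CircleRouche is the card's K2 (Rouché against the one-zero LSD model).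
Lean: `∃ δ : ℝ, 0 < δ ∧ ∃ x₀ : ℕ, ∀ x : ℕ, x₀ ≤ x → ∀ z : ℂ, ‖z‖ < δ → (∑ n ∈ Finset.Icc 1 x, z ^
(ArithmeticFunction.cardDistinctFactors (n ^ 2 + 1) - 1)) ≠ 0`

## Assembly
Pure logic given the four items (checked as an `example` in Sketch.lean, rc 0): from ZeroFreeDisc
(δ, x₀) and RealAxisOrder,
instantiate MontelTransfer with δ' = min(δ, 1/2), a_x(j) := π_{j+1}(x)/x = #{1≤n≤x : ω(n²+1) =
j+1}/x ≥ 0, N_x := x²+2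
(> max ω), L_x := loglog x → ∞: (i) Σ_j a_x(j) z^j = P_x(z)/x (regroup the sum over n by the value
of ω: Finset.sum_fiberwise),
so zero-freeness on |z| < δ' is ZeroFreeDisc; (ii) the anchor: Σ_j a_x(j)σ^j = M_x(σ)/(σx) and
RealAxisOrder gives
log(M_x(σ)/(σx)) = (σ−1)·loglog x + O_σ(1), whence the limit σ−1; MontelTransfer returns
log(π₁(x)/x)/loglog x → −1, which is
verbatim the hypothesis of PrimePowersToLandau; conclude LandauConjecture. The cruxes CircleRouche
and HalfPlaneGap enter only
through the supports RoucheToDisc / HalfPlaneToDisc as alternative sufficient conditions for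
ZeroFreeDisc (layer-2 glue foreseen below).
The endpoint is Literature.NumberTheory.Sieve.LandauConjecture — the qualitative n²+1-instance of
Summit.Parity.BatemanHorn with the
Bateman–Horn EXPONENT (as route SelbergDelange ends at HardyLittlewoodConjE); the constant and
general (f₁,…,f_k) are not claimed here.

Rationale: WHY THIS LINE. M_x(z) = Σ_{n≤x} z^{ω(n²+1)} = z·P_x(z) is, in the activity w = z−1, exactly the
complete Legendre sieve series
Σ_d μ²(d) w^{ω(d)} A_d(x) of n²+1 — a polymer partition function whose hard-core point w = −1 (z =
0) carries Landau's
count as its residue; the Lee–Yang / de la Vallée-Poussin move (LeeYang1952, Ruelle arXiv:0811.1327,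
Barvinok2016 §2;
in combinatorics LPRS arXiv:1408.4153 and Michelen–Sahasrabudhe arXiv:1804.07696 derive CLTs from
zero-free regions)
is to replace every asymptotic by a ZERO-FREE REGION in the sieve-dimension variable z: a zero-free
disc plus the
parity-free real-axis anchor M_x(σ) ≍ x(log x)^{σ−1} (0<σ<1, fundamental lemma of dimension 1−σ < 1
at level x^{1/2},
Literature `SieveSequence.fundamental_lemma_uniform` + `rho_sieveConditionOne`, both proved) pins
the normal family
(loglog x)⁻¹ log(P_x/x) to z−1 by the identity theorem and evaluates it at 0 — a Gärtner–Ellis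
large-deviation
statement pushed to the endpoint ω = 1, where the LDP alone is blind (Selberg's fake measure
1+λ(n²+1) has the same
anchor and π₁ = 0; its partition polynomial E_x = even part of M_x has a double zero at 0 and a wall
of zeros on iℝ
marching to 0, ±0.934i at x = 10⁶). Imported areas: statistical mechanics / geometry of polynomials
(zero loci of
positive-coefficient partition functions, Hermite–Biehler stability), complex function theory
(Montel, Vitali–Porter,
maximum modulus), sieve theory only for the anchor. Versus prior routes: SelbergDelange (same M_x)
assumes an LSD
ASYMPTOTIC on an open set (a level-x² complex divisor problem) AND two-sided normal-family BOUNDS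
around 0 and ends at
HL-E with constant; here the sole hypothesis is a zero LOCUS, the anchor is elementary and proved in
the tree, the
endpoint is the exponent form (LandauConjecture), and parity is located exactly (gap of M_x vs wall
of E_x at the
hard-core point). Calibration: for f = X the hypothesis is a THEOREM (Selberg1954, Tenenbaum2015
II.5–II.6:
Σ_{n≤x} z^{ω(n)}/z is zero-free on |z| ≤ 1−ε for large x). Negatives index empty at filing.

RANKED CRUXES. #2 ZeroFreeDisc (crux) — card K1. There is δ > 0 and x₀ such that for all x ≥ x₀ the
polynomial P_x(z) = Σ_{1≤n≤x} z^{ω(n²+1)−1} (ω = number of distinct prime factors; ω(n²+1) ≥ 1) has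
no zero in |z| < δ. Numerics (card, exact root-sieve to 10⁶; sibling card to 10⁷): nearest zero
−0.83±0.22i at 10⁶, −0.93±0.08i at 10⁷, modulus ≥ 0.448 at every sampled x ≥ 10², ≥ 0.83 for x ≥
2·10⁵; predicted limit zeros −1 (double), −3/2, −2, −3, −11/2 (zeros of λ_f(z)/Γ(1+z)). [difficulty:
open-problem] (why it might fail: Landau-complete: if primes n²+1 are scarce (π₁ = o(π₂/loglog x))
Newton's identities force a zero of modulus ≲ π₁/π₂ → 0; no soft proof exists and zero-exclusion
tools (Asano–Ruelle, stability preservers) may need exact product structure that the segment [1,x]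
of the CRT torus lacks.) [LeeYang1952, arXiv:0811.1327, Barvinok2016, Tenenbaum2015, Selberg1954,
arXiv:1408.4153, arXiv:0807.4739]
#3 CircleRouche (crux) — card K2, the sharp parity-located form: for some δ ∈ (0,1) and all large x,
on the circle |z| = δ the finite LSD model p_x(z) := x (2 log x)^{z−1} λ_x(z)/Γ(z+1), λ_x(z) =
Π_{p≤x}(1 + (z−1)ρ(p)/p)(1 − 1/p)^{z−1} (ρ(p) = #{ν mod p : ν²+1 ≡ 0}; λ_x is zero-free on |z| < 1
since its zeros are 1 − p/ρ(p) ∈ {−1, −3/2, −11/2, …}) dominates strictly: |P_x(z) − p_x(z)| <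
|p_x(z)|. On the arc Re z < 0 this is cancellation in the alternating almost-prime sums Σ_j π_j(x)
z^{j−1} down to the model size x(log x)^{Re z−1}, a saving (log x)^{Re z−|z|} over the trivial bound
P_x(|z|) — the damped 'polynomial Chowla' content, confined by δ^{ω} to n²+1 with ≲ e·δ·loglog x
prime factors; at z = δ it is the LSD law up to a factor < 2; implies ZeroFreeDisc (support
RoucheToDisc). Numerics: |M_x(−1/4)|/x = 4.5·10⁻³ at x = 10⁶, the model size and sign. [difficulty:
open-problem] (why it might fail: On Re z<0 it is a 99%-type cancellation (relative error <1, saving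
(log x)^{Re z−|z|}) among signed almost-prime counts of n²+1 — inside SelbergParityBarrier's
content; even at z=δ>0 the factor-<2 comparison with λ/Γ presumes PD(1) large-prime statistics of
n²+1, unproved.) [Tenenbaum2015, NairTenenbaum1998, IwaniecInventiones1978, arXiv:2010.07924,
Selberg1954]
#4 HalfPlaneGap (crux) — Conjecture HS (carried over from the merged card
lee-yang-zeros-hurwitz-landau): there is c > 0 such that for all large x every zero ρ of P_x
satisfies Re ρ ≤ −c — uniform Hurwitz stability of P_x(z − c). By Hermite–Biehler this is the
statement that the two PARITY WALLS interlace: the zeros of the even part E_x (partition polynomial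
of Selberg's fake measure 1+λ(n²+1) up to the non-squarefree correction) and of the odd part O_x
(measure 1−λ(n²+1)), both of which lie on iℝ-symmetric sets, alternate along the imaginary axis
after the shift by c; equivalently total positivity of the Hurwitz matrix of the almost-prime counts
(π_j(x))_j. Trivially implies ZeroFreeDisc with δ = c (support HalfPlaneToDisc). Numerics (both
cards): all computed zeros have Re ≤ −0.79 for 2·10⁵ ≤ x ≤ 10⁷; far zeros real and ≪ 0 (−45.6, −109,
−370 at 10⁷). [difficulty: open-problem] (why it might fail: Strictly stronger than needed: FAR
zeros (radius ≍ deg P_x ≈ 2log x/loglog x, driven by friable values of n²+1 with abnormal ω) are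
uncontrolled and could enter Re z > 0 without touching Landau; the Ω-analogue Σ z^{Ω(n²+1)} already
has zeros at 2.0±5.6i (x = 10⁵).) [Hurwitz1896, Hermite1873, BorceaBranden2009, arXiv:1804.07696,
Tenenbaum2015]
#9 RealAxisOrder (support) — card P2 (anchor), provable now. For every σ ∈ (0,1) there are 0 < c ≤ C
with c·x(log x)^{σ−1} ≤ M_x(σ) = Σ_{1≤n≤x} σ^{ω(n²+1)} ≤ C·x(log x)^{σ−1} for all large x. Proof
route: with z = x^ε, T := Σ_n σ^{ω_z(n²+1)} satisfies σ^{3/ε}T ≤ M_x(σ) ≤ T (n²+1 ≤ x²+1 has ≤ 3/ε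
prime factors ≥ x^ε); the exact identity σ^{ω_z(m)} = Σ_{S ⊆ {p<z}} (1−σ)^{|S|} σ^{π(z)−|S|} 1[(m,
Π_{p∈S} p) = 1] writes T as a convex combination of honest sifting functions S_S(x) = #{n ≤ x : p ∤
n²+1 ∀p ∈ S}; the UNIFORM fundamental lemma
(Literature.NumberTheory.Sieve.SieveSequence.fundamental_lemma_uniform, proved:
fundamental_lemma_uniform_holds; dimension ≤ 2 uniformly in S via rho_sieveConditionOne, density
g(p) = ρ(p)/p on S and 0 off S, level D = x^{1/2}, remainders |r_d| ≤ ρ(d)) gives S_S(x) =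
x·Π_{p∈S}(1−ρ(p)/p)(1 + O(e^{−1/(2ε)})) + O(x^{1/2} log x); averaging over S, T = x·Π_{p<x^ε}(1 −
(1−σ)ρ(p)/p)·(1 + O(e^{−1/(2ε)})) + O(x^{1/2}log x) ≍ x(log x)^{σ−1} by Mertens for ρ
(RhoMertensStrong_holds: Σ_{p≤y} ρ(p)/p = loglog y + O(1)); fix ε = ε(κ,K) small. [difficulty:
provable-now] [FriedlanderIwaniecOpera2010, HalberstamRichert1974, IwaniecInventiones1978,
NairTenenbaum1998]
#9 MontelTransfer (support) — card P1 in abstract form (pure complex analysis, provable now with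
Literature/Analysis/Complex/{Montel, VitaliConvergence, HolomorphicPrimitives, HarnackHalfPlane}):
let a_x(j) ≥ 0, P_x(z) = Σ_{j<N_x} a_x(j) z^j, L_x → ∞; if eventually P_x has no zero in |z| < δ and
for every σ ∈ (0,δ) log P_x(σ)/L_x → σ−1, then log a_x(0)/L_x → −1. Proof: ψ_x := L_x⁻¹ log P_x
(holomorphic branch on the disc, real on [0,δ); exists since P_x is zero-free, a_x(0) = P_x(0) > 0);
majorant |P_x(z)| ≤ P_x(|z|) ≤ P_x(δ') for |z| ≤ δ' < δ gives Re ψ_x ≤ ψ_x(δ') → δ'−1 < 0, so {ψ_x}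
maps D_{δ'} into a half-plane ⇒ normal (Montel after a Möbius map, or Borel–Carathéodory/Harnack +
Cauchy estimates); every subsequential limit is holomorphic and equals z−1 on (0,δ') hence on D_{δ'}
(identity theorem); evaluate at 0; conclude by tendsto_of_subseq_tendsto. [difficulty: provable-now]
[arXiv:1408.4153, Barvinok2016, Tenenbaum2015]
#9 PrimePowersToLandau (support) — card P3, elementary: if log(#{1≤n≤x : ω(n²+1) = 1}/x)/loglog x →
−1 then {n : n²+1 prime} is infinite. Proof: ω(n²+1) = 1 ⟺ n²+1 = p^k; k even is impossible for n ≥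
1 (consecutive squares), k ≥ 3 odd gives ≤ Σ_{3≤k≤log₂(x²+1)} (x²+1)^{1/k} ≤ 3x^{2/3}log₂(x²+1)
values of n ≤ x (each p^k has at most one n); were the prime set finite (≤ N elements) the count
would be ≤ N + O(x^{2/3}log x) and the normalised log would tend to −∞, not −1. [difficulty:
provable-now] [HardyLittlewood1923, Landau1912ICM]
#9 RoucheToDisc (support) — glue CircleRouche → ZeroFreeDisc, provable now WITHOUT Rouché: for x ≥
x₀ the model p_x is holomorphic and zero-free on the closed disc |z| ≤ δ < 1 (x ≠ 0; cpow of
positive reals ≠ 0; 1 + (z−1)ρ(p)/p = 0 only at z = 1 − p/ρ(p) of modulus ≥ 1 because ρ(2) = 1, ρ(3)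
= 0, ρ(p) ≤ 2 for p ≥ 5 (rho_eq_polyRootCountMod and the ρ-lemmas of IwaniecAlmostPrimes); 1/Γ(z+1)
entire and ≠ 0 for |z| < 1), so g := P_x/p_x − 1 is holomorphic on a neighbourhood of the closed
disc with ‖g‖ < 1 on |z| = δ (compact ⇒ max < 1); the maximum modulus principle
(Complex.norm_le_of_forall_mem_frontier_norm_le) gives ‖g‖ < 1 inside, hence P_x ≠ 0 on |z| < δ;
smaller x are absorbed in x₀. [difficulty: provable-now] [Tenenbaum2015, IwaniecInventiones1978]
#9 HalfPlaneToDisc (support) — glue HalfPlaneGap → ZeroFreeDisc: take δ = c; a zero z with ‖z‖ < c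
would have Re z ≥ −‖z‖ > −c (Complex.abs_re_le_norm), contradiction. Proved as an `example` in the
planner's Sketch.lean (5 lines). [difficulty: provable-now] [Hurwitz1896]

TWO-LAYER PLAN. Foreseen glued splits (nothing filed now; k ≤ 3, depth 1): ZeroFreeDisc ⇐
CircleRouche → RoucheToDisc → ZeroFreeDisc and
ZeroFreeDisc ⇐ HalfPlaneGap → HalfPlaneToDisc → ZeroFreeDisc (glue already filed as support);
CircleRouche ⇐ RightArcLSD (the
comparison |P_x/p_x − 1| < 1 on |z| = δ, |arg z| ≤ π/2 + η: parity-free, a LEVEL problem = the disc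
analogue of
SelbergDelange.LSDOpenSet at radius δ) → LeftArcCancellation (the arc Re z < −η·δ: the signed
almost-prime cancellation) →
CircleRouche; HalfPlaneGap ⇐ NearZeroStability (zeros with |z| ≤ R(x₀) stay in Re z ≤ −c:
Hermite–Biehler interlacing of the
E_x/O_x walls near the origin) → FarZeroConfinement (zeros with |z| > R are real negative:
Eneström–Kakeya / ratio monotonicity of
the high almost-prime counts π_j(x), a friable-values statement) → HalfPlaneGap; RealAxisOrder ⇐
upper half (trivial majorant +
upper-bound sieve) / lower half (fundamental lemma + ≤ 3/ε large primes), attached by provers with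
--supports, not as items.

KILL CRITERIA. ¬ZeroFreeDisc proved (for every δ > 0, zeros of P_x inside |z| < δ for infinitely
many x) closes the route `refuted:ZeroFreeDisc`;
since the LSD law with (log x)^{−A} uniformity near 0 implies ZeroFreeDisc (Hurwitz), such a theorem
is also negative knowledge
against SelbergDelange.LSDOpenSet ∧ NormalFamilyBound and is filed there. ¬CircleRouche (an Ω-result
|P_x(−δ)| ≥ |p_x(−δ)|·2
infinitely often for every δ) or ¬HalfPlaneGap (far zeros in Re z > 0) are NOT fatal: drop the crux
(`--drop`, the assembly does not
use it) and record which arc / which radius failed. A numerical zero of P_x with |z| < 0.4 at some x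
∈ [10⁶, 10⁹], or a nearest-zero
modulus DEcreasing along x = 2^k·10⁶, does not refute the ∃δ-eventually statement but retires the
line's evidence ⇒ pivot to the
shrinking-radius form (δ(x) = c/loglog x suffices for nothing; close as exhausted if that is all
that survives). RealAxisOrder /
MontelTransfer / PrimePowersToLandau / RoucheToDisc refuted ⇒ planner bookkeeping error ⇒
`--restate`. HardyLittlewoodConjE or
LandauConjecture proved elsewhere moots the route; SelbergDelange's two cruxes proved ⇒ ZeroFreeDisc
becomes their corollary
(Hurwitz) and this route closes `superseded`.

NOT DECOMPOSED YET. (i) The k-variable / general-f version (zero-free polydisc for Σ_n Π_i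
z_i^{ω(f_i(n))}, k-dimensional anchors, several-variable
Montel ⇒ #{n ≤ x : all f_i(n) prime} = x(log x)^{−k+o(1)}, twin primes included) — a separate route
once ZeroFreeDisc moves.
(ii) The CONSTANT: HL-E with 𝔖 needs convergence of (2 log x)^{1−z}P_x(z)/x near 0, i.e.
SelbergDelange.LSDOpenSet ∧
NormalFamilyBound, or the sibling card almost-prime-polynomial-zeros' zero statistic T_f(x) =
Σ_ρ|1−ρ|⁻² = O(1) ⇒ NormalFamilyBound
(Hadamard bookkeeping) — deliberately left to that card / route SelbergDelange; ZeroFreeDisc is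
their common qualitative shadow.
(iii) The linear calibration (f = X: P_x zero-free on |z| ≤ 1−ε for large x, a theorem by
Selberg–Delange via ζ(s)^z,
Tenenbaum2015 II.5 Thm 5.2 / II.6) — true but an XL formalisation (complex powers of ζ, Hankel
contour) and not load-bearing.
(iv) The function-field model (Sawin–Shusterman regime; CCG bias ⇒ zeros on iℝ) — calibration of the
sibling card, not filed.
(v) Quantitative dependence of x₀ on δ, and any use of the transfer for π_j, j ≥ 2 (derivatives at
0) — layer-2 children later.

CHEAPEST FALSIFIER. One kit job (root-sieve factorisation of n²+1 for n ≤ 10⁸–10⁹, companion-matrix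
eigenvalues of P_x at x = 2^k·10⁶; minutes to
hours): (a) is min|zero| ≥ 0.4 at every x and non-decreasing in x (ZeroFreeDisc evidence; card: ≥
0.448 for all sampled
x ∈ [10², 10⁶], ≥ 0.83 for x ≥ 2·10⁵; sibling: −0.93±0.08i nearest at 10⁷)? (b) max Re(zero) ≤ −0.5
(HalfPlaneGap; cards:
≤ −0.79 for x ≥ 2·10⁵)? (c) max_{|z|=δ} |P_x(z)/p_x(z) − 1| < 1 for δ ∈ {1/4, 1/2, 3/4}
(CircleRouche; card: |M_x(−1/4)|/x =
4.5·10⁻³ = model size and sign at 10⁶)? Any failure that worsens with x retires the corresponding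
crux. Literature lookup already
run (this session and the card's): no printed zero-location result for Σ_{n≤x} z^{ω(f(n))}, deg f ≥
2, was found (zbMATH,
galaxy pdf intelligent, local hybrid); the nearest analytic results derive CLTs, not tail atoms,
from zero-free regions
(arXiv:1408.4153, arXiv:1804.07696).

NUMBERS. Nearest zero of P_x (f = X²+1): −0.68±0.29i (10⁵), −0.79±0.25i (2·10⁵), −0.82±0.20i
(4.1·10⁵), −0.84±0.24i (8.2·10⁵),
−0.83±0.22i (10⁶) [card]; −0.93±0.08i, −1.65, −1.81±0.17i, −6.0, −8.7, −45.6 (10⁷)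
[almost-prime-polynomial-zeros]. Predicted
limit zeros: −1 (double: p = 2 and Γ), −3/2 (p = 5), −2, −3 (Γ), −11/2 (p = 13). Parity wall of E_x:
±i·y(x), y = 4.20 → 0.934
monotonically over x = 10²…10⁶. |M_x(−1/4)|/x = 4.5·10⁻³ ≈ 0.3(log x²)^{−5/4} at 10⁶. Linear case f
= X at 10⁵: nearest zeros
−0.706±0.094i (split double zero at −1); theorem: zero-free on |z| ≤ 1−ε eventually (Selberg–Delange
error O(1/log x)).
Delimiters: Σ z^{Ω(n²+1)} has zeros in Re z > 0 near |z| = 5 (2.04±5.6i at 25600) — the mechanism is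
specific to ω. Fundamental
lemma range: two-sided bound with e^{−s}, s = log D/log z (Friedlander–Iwaniec Lemma 6.8: s ≥ 9κ+1
explicit). Items at open: 9
(3 cruxes, 5 supports, 1 assembly).

DEFINITION REQUESTS. None. Everything is inlined over existing declarations: ω =
ArithmeticFunction.cardDistinctFactors (Mathlib), ρ(p) =
Literature.NumberTheory.Sieve.polyRootCountMod ![X²+1] p (same term as SelbergDelange.LSDOpenSet /
EulerFactorAtZero, so the Euler
factor lemmas are shared), target Literature.NumberTheory.Sieve.LandauConjecture (needs the extra
import
Literature.NumberTheory.Sieve.ParityWave0, declared in the front-matter). A convenience `def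
omegaPartitionPoly (f : ℤ[X]) (x : ℕ) :
Polynomial ℕ` under Summits/Parity/BatemanHorn/Theorems would shorten provers' files but is not
requested as an item.

Novelty: Searches (2026-08-15, this session, on top of the card's and the triage refuter's logged searches):
`lit frontier Parity --since 2020`
(30 rows; relevant only arXiv:2605.01155 Banks–Ford 'Sets of integers satisfying Bateman–Horn
statistics' (random model, read pp. 1–2)
and arXiv:2603.13416 (HL for almost-prime tuples); none on zeros of Σ z^{ω(f(n))}); `lit bridges
Parity --cross any` (30 rows, no
Lee–Yang/stat-mech bridge); `lit search --source zbmath` ×8 ('zeros polynomial number of prime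
divisors omega generating function' 0;
'Lee-Yang theorem number theory primes' 1 = doi:10.1063/1.531717 Contucci–Knauf; 'Knauf spin chain
zeta function phase transition' 4 =
Knauf1993 family; 'Hermite-Biehler stability … primes' 0; 'Selberg-Delange method polynomial values
prime divisors' 0; 'number of prime
factors of n^2+1 distribution' 12 noise; LPRS and Michelen–Sahasrabudhe located: arXiv:1408.4153,
arXiv:1804.07696, arXiv:1908.09020;
Ruelle arXiv:0811.1327); `lit galaxy search "Lee-Yang zeros in number theory" --star all` (0/0/0);
`lit galaxy search --star pdf --mode
intelligent "zeros of the polynomial whose coefficients count integers with k prime factors"` (12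
rows, none relevant: Elliott survey,
Dartyge friable survey, stability-domain papers); `lit search --hybrid --source local` ×2 (Lieb
Stat. Mech. Lee–Yang pages; Harman,
Opera de Cribro, Hall–Tenenbaum Divisors, Kowalski 2021 p. 39 mod-Poisson — no junction);
openalex/s2 rate-limited (logged); all 9
BatemanHorn route files and  [refs: 10.1063/1.531717, 2605.01155, 2603.13416, 1408.4153, 1804.07696, 1908.09020, 0811.1327, 0807.4739, doi:10.1063/1.531717, Knauf1993, Selberg1954, Tenenbaum2015, Barvinok2016, BorceaBranden2009, LeeYang1952]

Barriers (technique_class: zero-free-region lee-yang normal-families sieve-anchor): - technique_class: zero-free-region lee-yang normal-families sieve-anchor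
- Literature.Barriers.Parity.SelbergParityBarrier: respected, not dissolved — Type-I data enter ONLY
the anchor RealAxisOrder (a sieve of dimension 1−σ < 1 at level x^{1/2}, far from any sieve limit)
which Selberg's fake measures 1±λ(n²+1) satisfy equally; the prime-producing hypothesis is a zero
LOCUS, a non-linear property of the whole coefficient vector (π_j(x))_j that the fake measure
violates by construction (E_x(0) = E_x'(0) = 0, wall on iℝ), so no functional of Type-I data is
asked to see primes; conceded that ZeroFreeDisc is Landau-complete — the barrier's content reappears
as 'why the wall stays open', and the bet is structural zero exclusion (CircleRouche, HalfPlaneGap)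
rather than a sifted lower bound.
- Literature.Barriers.Parity.FordMaynardMinimalTypeII: no Type-I/II prime-detecting decomposition is
used (the thin sequence n²+1 has none available); the non-Type-I input is the zero locus; it does
not evade the theorem that SOME such input is necessary — it names a candidate of a different kind.
- Literature.Barriers.Parity.FordMaynardLowLevel: same remark; level 1/2 is used only inside the
fundamental lemma for an order of magnitude, never for an asymptotic with main term.
- Literature.Barriers.Parity.FordFixedLevelBarrier: not engaged — no Λ_k-asymptotic is drawn from a
fixed level; the anchor is two-sided up to constants and the exponent is read off analytically.
- Literature.Barriers.Pari

History (route lifecycle, newest last):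
- 2026-08-15T15:58:17Z · CLOSED retired — not-a-thesis: assembly does not conclude the sub-problem Statement (planner-Parity-route-Parity-LeeYangDisc-0)

sub-problem: BatemanHorn · status: closed(retired) · opened planner-plancard-Parity-BatemanHorn-landau-le-1e8e24a7-0 2026-08-15T13:28:27Z · rev 0 · ledger route-Parity-LeeYangDisc
GENERATED by the gate from the ledger (D-0016/17). Provers cite these decls: `theorem foo : Summit.Parity.BatemanHorn.Theses.LeeYangDisc.<Decl> := …` in Summits/Parity/BatemanHorn/Theorems/<Name>.lean.
-/

namespace Summit.Parity.BatemanHorn.Theses.LeeYangDisc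

open scoped BigOperators Topology Manifold Classical MeasureTheory ProbabilityTheory Matrix InnerProductSpace ComplexConjugate ContinuousMap
open Filter Set Function TopologicalSpace MeasureTheory

attribute [summit_statement] _root_.BatemanHorn

/-- item stmt-Parity-8706 · crux · rank 2 · closed · moot by None · by planner
why it might fail: Landau-complete: if primes n²+1 are scarce (π₁ = o(π₂/loglog x)) Newton's identities force a zero of modulus ≲ π₁/π₂ → 0; no soft proof exists and zero-exclusion tools (Asano–Ruelle, stability preservers) may need exact product structure that the segment [1,x] of the CRT torus lacks.
sources: LeeYang1952, arXiv:0811.1327, Barvinok2016, Tenenbaum2015, Selberg1954, arXiv:1408.4153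
[crux] card K1. There is δ > 0 and x₀ such that for all x ≥ x₀ the polynomial P_x(z) = Σ_{1≤n≤x}
z^{ω(n²+1)−1} (ω = number of distinct prime factors; ω(n²+1) ≥ 1) has no zero in |z| < δ. Numerics
(card, exact root-sieve to 10⁶; sibling card to 10⁷): nearest zero −0.83±0.22i at 10⁶, −0.93±0.08i
at 10⁷, modulus ≥ 0.448 at every sampled x ≥ 10², ≥ 0.83 for x ≥ 2·10⁵; predicted limit zeros −1
(double), −3/2, −2, −3, −11/2 (zeros of λ_f(z)/Γ(1+z)). [difficulty: open-problem] -/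
@[route_item "route-Parity-LeeYangDisc"]
def ZeroFreeDisc : Prop :=
  ∃ δ : ℝ, 0 < δ ∧ ∃ x₀ : ℕ, ∀ x : ℕ, x₀ ≤ x → ∀ z : ℂ, ‖z‖ < δ → (∑ n ∈ Finset.Icc 1 x, z ^ (ArithmeticFunction.cardDistinctFactors (n ^ 2 + 1) - 1)) ≠ 0

/-- item stmt-Parity-8707 · crux · rank 3 · closed · moot by None · by planner
why it might fail: On Re z<0 it is a 99%-type cancellation (relative error <1, saving (log x)^{Re z−|z|}) among signed almost-prime counts of n²+1 — inside SelbergParityBarrier's content; even at z=δ>0 the factor-<2 comparison with λ/Γ presumes PD(1) large-prime statistics of n²+1, unproved.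
sources: Tenenbaum2015, NairTenenbaum1998, IwaniecInventiones1978, arXiv:2010.07924, Selberg1954
[crux] card K2, the sharp parity-located form: for some δ ∈ (0,1) and all large x, on the circle |z|
= δ the finite LSD model p_x(z) := x (2 log x)^{z−1} λ_x(z)/Γ(z+1), λ_x(z) = Π_{p≤x}(1 +
(z−1)ρ(p)/p)(1 − 1/p)^{z−1} (ρ(p) = #{ν mod p : ν²+1 ≡ 0}; λ_x is zero-free on |z| < 1 since its
zeros are 1 − p/ρ(p) ∈ {−1, −3/2, −11/2, …}) dominates strictly: |P_x(z) − p_x(z)| < |p_x(z)|. On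
the arc Re z < 0 this is cancellation in the alternating almost-prime sums Σ_j π_j(x) z^{j−1} down
to the model size x(log x)^{Re z−1}, a saving (log x)^{Re z−|z|} over the trivial bound P_x(|z|) —
the damped 'polynomial Chowla' content, confined by δ^{ω} to n²+1 with ≲ e·δ·loglog x prime factors;
at z = δ it is the LSD law up to a factor < 2; implies ZeroFreeDisc (support RoucheToDisc).
Numerics: |M_x(−1/4)|/x = 4.5·10⁻³ at x = 10⁶, the model size and sign. [difficulty: open-problem] -/
@[route_item "route-Parity-LeeYangDisc"]
def CircleRouche : Prop :=
  ∃ δ : ℝ, 0 < δ ∧ δ < 1 ∧ ∃ x₀ : ℕ, ∀ x : ℕ, x₀ ≤ x → ∀ z : ℂ, ‖z‖ = δ → ‖(∑ n ∈ Finset.Icc 1 x, z ^ (ArithmeticFunction.cardDistinctFactors (n ^ 2 + 1) - 1)) - (x : ℂ) * ((2 * Real.log x : ℝ) : ℂ) ^ (z - 1) * (∏ p ∈ Nat.primesLE x, ((1 + (z - 1) * ((Literature.NumberTheory.Sieve.polyRootCountMod ![(Polynomial.X ^ 2 + 1 : Polynomial ℤ)] p : ℕ) : ℂ) / (p : ℂ))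 * (1 - 1 / (p : ℂ)) ^ (z - 1))) / Complex.Gamma (z + 1)‖ < ‖(x : ℂ) * ((2 * Real.log x : ℝ) : ℂ) ^ (z - 1) * (∏ p ∈ Nat.primesLE x, ((1 + (z - 1) * ((Literature.NumberTheory.Sieve.polyRootCountMod ![(Polynomial.X ^ 2 + 1 : Polynomial ℤ)] p : ℕ) : ℂ) / (p : ℂ)) * (1 - 1 / (p : ℂ)) ^ (z - 1))) / Complex.Gamma (z + 1)‖

/-- item stmt-Parity-8708 · crux · rank 4 · closed · moot by None · by planner
why it might fail: Strictly stronger than needed: FAR zeros (radius ≍ deg P_x ≈ 2log x/loglog x, driven by friable values of n²+1 with abnormal ω) are uncontrolled and could enter Re z > 0 without touching Landau; the Ω-analogue Σ z^{Ω(n²+1)} already has zeros at 2.0±5.6i (x = 10⁵).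
sources: Hurwitz1896, Hermite1873, BorceaBranden2009, arXiv:1804.07696, Tenenbaum2015
[crux] Conjecture HS (carried over from the merged card lee-yang-zeros-hurwitz-landau): there is c >
0 such that for all large x every zero ρ of P_x satisfies Re ρ ≤ −c — uniform Hurwitz stability of
P_x(z − c). By Hermite–Biehler this is the statement that the two PARITY WALLS interlace: the zeros
of the even part E_x (partition polynomial of Selberg's fake measure 1+λ(n²+1) up to the
non-squarefree correction) and of the odd part O_x (measure 1−λ(n²+1)), both of which lie on
iℝ-symmetric sets, alternate along the imaginary axis after the shift by c; equivalently total
positivity of the Hurwitz matrix of the almost-prime counts (π_j(x))_j. Trivially implies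
ZeroFreeDisc with δ = c (support HalfPlaneToDisc). Numerics (both cards): all computed zeros have Re
≤ −0.79 for 2·10⁵ ≤ x ≤ 10⁷; far zeros real and ≪ 0 (−45.6, −109, −370 at 10⁷). [difficulty:
open-problem] -/
@[route_item "route-Parity-LeeYangDisc"]
def HalfPlaneGap : Prop :=
  ∃ c : ℝ, 0 < c ∧ ∃ x₀ : ℕ, ∀ x : ℕ, x₀ ≤ x → ∀ z : ℂ, (∑ n ∈ Finset.Icc 1 x, z ^ (ArithmeticFunction.cardDistinctFactors (n ^ 2 + 1) - 1)) = 0 → z.re ≤ -c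

/-- item stmt-Parity-8709 · support · rank 9 · closed · moot by None · by planner
sources: FriedlanderIwaniecOpera2010, HalberstamRichert1974, IwaniecInventiones1978, NairTenenbaum1998
[support] card P2 (anchor), provable now. For every σ ∈ (0,1) there are 0 < c ≤ C with c·x(log
x)^{σ−1} ≤ M_x(σ) = Σ_{1≤n≤x} σ^{ω(n²+1)} ≤ C·x(log x)^{σ−1} for all large x. Proof route: with z =
x^ε, T := Σ_n σ^{ω_z(n²+1)} satisfies σ^{3/ε}T ≤ M_x(σ) ≤ T (n²+1 ≤ x²+1 has ≤ 3/ε prime factors ≥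
x^ε); the exact identity σ^{ω_z(m)} = Σ_{S ⊆ {p<z}} (1−σ)^{|S|} σ^{π(z)−|S|} 1[(m, Π_{p∈S} p) = 1]
writes T as a convex combination of honest sifting functions S_S(x) = #{n ≤ x : p ∤ n²+1 ∀p ∈ S};
the UNIFORM fundamental lemma
(Literature.NumberTheory.Sieve.SieveSequence.fundamental_lemma_uniform, proved:
fundamental_lemma_uniform_holds; dimension ≤ 2 uniformly in S via rho_sieveConditionOne, density
g(p) = ρ(p)/p on S and 0 off S, level D = x^{1/2}, remainders |r_d| ≤ ρ(d)) gives S_S(x) =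
x·Π_{p∈S}(1−ρ(p)/p)(1 + O(e^{−1/(2ε)})) + O(x^{1/2} log x); averaging over S, T = x·Π_{p<x^ε}(1 −
(1−σ)ρ(p)/p)·(1 + O(e^{−1/(2ε)})) + O(x^{1/2}log x) ≍ x(log x)^{σ−1} by Mertens for ρ
(RhoMertensStrong_holds: Σ_{p≤y} ρ(p)/p = loglog y + O(1)); fix ε = ε(κ,K) small. [difficulty:
provable-now] -/
@[route_item "route-Parity-LeeYangDisc"]
def RealAxisOrder : Prop :=
  ∀ σ : ℝ, 0 < σ → σ < 1 → ∃ c C : ℝ, 0 < c ∧ ∃ x₀ : ℕ, ∀ x : ℕ, x₀ ≤ x → c * (x : ℝ) * Real.log x ^ (σ - 1) ≤ ∑ n ∈ Finset.Icc 1 x, σ ^ (ArithmeticFunction.cardDistinctFactors (n ^ 2 + 1)) ∧ ∑ n ∈ Finset.Icc 1 x, σ ^ (ArithmeticFunction.cardDistinctFactors (n ^ 2 + 1)) ≤ C * (x : ℝ) * Real.log x ^ (σ - 1)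

/-- item stmt-Parity-8710 · support · rank 9 · closed · moot by None · by planner
sources: arXiv:1408.4153, Barvinok2016, Tenenbaum2015
[support] card P1 in abstract form (pure complex analysis, provable now with
Literature/Analysis/Complex/{Montel, VitaliConvergence, HolomorphicPrimitives, HarnackHalfPlane}):
let a_x(j) ≥ 0, P_x(z) = Σ_{j<N_x} a_x(j) z^j, L_x → ∞; if eventually P_x has no zero in |z| < δ and
for every σ ∈ (0,δ) log P_x(σ)/L_x → σ−1, then log a_x(0)/L_x → −1. Proof: ψ_x := L_x⁻¹ log P_x
(holomorphic branch on the disc, real on [0,δ); exists since P_x is zero-free, a_x(0) = P_x(0) > 0);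
majorant |P_x(z)| ≤ P_x(|z|) ≤ P_x(δ') for |z| ≤ δ' < δ gives Re ψ_x ≤ ψ_x(δ') → δ'−1 < 0, so {ψ_x}
maps D_{δ'} into a half-plane ⇒ normal (Montel after a Möbius map, or Borel–Carathéodory/Harnack +
Cauchy estimates); every subsequential limit is holomorphic and equals z−1 on (0,δ') hence on D_{δ'}
(identity theorem); evaluate at 0; conclude by tendsto_of_subseq_tendsto. [difficulty: provable-now] -/
@[route_item "route-Parity-LeeYangDisc"]
def MontelTransfer : Prop :=
  ∀ (δ : ℝ) (a : ℕ → ℕ → ℝ) (N : ℕ → ℕ) (L : ℕ → ℝ), 0 < δ → (∀ x j, 0 ≤ a x j) → Filter.Tendsto L Filter.atTop Filter.atTop → (∀ᶠ x in Filter.atTop, ∀ z : ℂ, ‖z‖ < δ → (∑ j ∈ Finset.range (N x), (a x j : ℂ) * z ^ j) ≠ 0) → (∀ σ : ℝ, 0 < σ → σ < δ → Filter.Tendsto (fun x => Real.log (∑ j ∈ Finset.range (N x), a x j * σ ^ j) / L x) Filter.atTop (nhds (σ - 1))) → Filter.Tendsto (fun x => Real.log (a x 0) / L x) Filter.atTop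 (nhds (-1))

/-- item stmt-Parity-8711 · support · rank 9 · closed · moot by None · by planner
sources: HardyLittlewood1923, Landau1912ICM
[support] card P3, elementary: if log(#{1≤n≤x : ω(n²+1) = 1}/x)/loglog x → −1 then {n : n²+1 prime}
is infinite. Proof: ω(n²+1) = 1 ⟺ n²+1 = p^k; k even is impossible for n ≥ 1 (consecutive squares),
k ≥ 3 odd gives ≤ Σ_{3≤k≤log₂(x²+1)} (x²+1)^{1/k} ≤ 3x^{2/3}log₂(x²+1) values of n ≤ x (each p^k has
at most one n); were the prime set finite (≤ N elements) the count would be ≤ N + O(x^{2/3}log x)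
and the normalised log would tend to −∞, not −1. [difficulty: provable-now] -/
@[route_item "route-Parity-LeeYangDisc"]
def PrimePowersToLandau : Prop :=
  Filter.Tendsto (fun x : ℕ => Real.log ((((Finset.Icc 1 x).filter (fun n => ArithmeticFunction.cardDistinctFactors (n ^ 2 + 1) = 1)).card : ℝ) / (x : ℝ)) / Real.log (Real.log (x : ℝ))) Filter.atTop (nhds (-1)) → Literature.NumberTheory.Sieve.LandauConjecture

/-- item stmt-Parity-8712 · support · rank 9 · closed · moot by None · by planner
sources: Tenenbaum2015, IwaniecInventiones1978
[support] glue CircleRouche → ZeroFreeDisc, provable now WITHOUT Rouché: for x ≥ x₀ the model p_x is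
holomorphic and zero-free on the closed disc |z| ≤ δ < 1 (x ≠ 0; cpow of positive reals ≠ 0; 1 +
(z−1)ρ(p)/p = 0 only at z = 1 − p/ρ(p) of modulus ≥ 1 because ρ(2) = 1, ρ(3) = 0, ρ(p) ≤ 2 for p ≥ 5
(rho_eq_polyRootCountMod and the ρ-lemmas of IwaniecAlmostPrimes); 1/Γ(z+1) entire and ≠ 0 for |z| <
1), so g := P_x/p_x − 1 is holomorphic on a neighbourhood of the closed disc with ‖g‖ < 1 on |z| = δ
(compact ⇒ max < 1); the maximum modulus principle (Complex.norm_le_of_forall_mem_frontier_norm_le)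
gives ‖g‖ < 1 inside, hence P_x ≠ 0 on |z| < δ; smaller x are absorbed in x₀. [difficulty:
provable-now] -/
@[route_item "route-Parity-LeeYangDisc"]
def RoucheToDisc : Prop :=
  CircleRouche → ZeroFreeDisc

/-- item stmt-Parity-8713 · support · rank 9 · closed · moot by None · by planner
sources: Hurwitz1896
[support] glue HalfPlaneGap → ZeroFreeDisc: take δ = c; a zero z with ‖z‖ < c would have Re z ≥ −‖z‖
> −c (Complex.abs_re_le_norm), contradiction. Proved as an `example` in the planner's Sketch.lean (5
lines). [difficulty: provable-now] -/
@[route_item "route-Parity-LeeYangDisc"]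
def HalfPlaneToDisc : Prop :=
  HalfPlaneGap → ZeroFreeDisc

/-- item stmt-Parity-8714 · assembly · rank 1 · closed · moot by None · by planner
sources: HardyLittlewood1923, BatemanHorn1962, Tenenbaum2015
[assembly] ZeroFreeDisc → RealAxisOrder → MontelTransfer → PrimePowersToLandau → LandauConjecture
(infinitely many primes n²+1, with π₁(x) = x(log x)^{−1+o(1)} extracted on the way). -/
@[route_item "route-Parity-LeeYangDisc"]
def Assembly : Prop :=
  ZeroFreeDisc → RealAxisOrder → MontelTransfer → PrimePowersToLandau → Literature.NumberTheory.Sieve.LandauConjecture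

end Summit.Parity.BatemanHorn.Theses.LeeYangDisc
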